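import Summits.QuantumFields.YangMills.Theorems.UnitScaleTiltProp7DivRecoveryAssemblyHilbert
import Summits.QuantumFields.YangMills.Theorems.UnitScaleTiltProp7DescentStraightCloseness
import HarnessLib

/-!
# Prop. 7 on T³ — lane II (B7-MEMBER-CORE-PACKAGED): the member core row with its constants chosen BEFORE the member

Route `UnitScaleTilt`, crux `MinimiserStabilityRegPr` (stmt-QuantumFields-19200), E′ growth side, lane II «divergence recovery at the curved regular member».
✓`Prop7DivRecoveryAssemblyHilbert.member_core_row` with its four member-level inputs supplied as THEOREM SCHEMAS (constants before `F n K e W`):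
(B2a) `hB2a` = SIGNATURE-0 `exists_smoothRightInverse_QprimeCombL2` VERBATIM (pen px3 g6), taken at the transporter `T := Ū = descendToGL … (bgUnits W)` whose two
riders are w1 g15's ✓`intertwining_rows` (first conjunct, `U1`) and w4-20520 g12's ✓`descent_straight_closeness` ((B3c)); (B3a) ✓`intertwining_rows` (second conjunct)
BY NAME; (QH1)♮ `hQH1` (pen px19 g6) for an arbitrary nonnegative member functional `H`; the coarse contractions (GN)∕(QN) as the hypothesis `hGQ` whose text
IS the statement of routeR-w3 g8's ✓`Prop7DivRecoveryCoarseRows.coarse_rows c₀` (`CG = 12`, `CN = 1`; discharged by `exact coarse_rows c₀` at the knit).  Output: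
`∀ L, 1<L → ∃ a₁ a₂ a₃ a₄ ≥ 0, 0 < eM ≤ 1, ∀ member (0 < e ≤ eM, RegPr) ∀ cutoffs∕potentials, ‖g‖² ≤ a₁·(c₀∕cB)ℓ³‖Qkc y‖² + a₂(…) + a₃(…) + a₄e²‖ΣZφ‖² + 3(…) + 3(…)`
— the core row in the shape ✓`Prop7DivRecoveryCollectedOfRows.hColl_of_rows` consumes (`a₂ a₃` are `s`-free: they do not see the patch scale at all).

HONEST SCOPE.  Bookkeeping (`e ≤ 1` absorptions, `min` of radii); the schemas `hB2a hQH1` are OPEN with named pens, `hGQ` is ✓`coarse_rows c₀` verbatim; nothing of (REC)∕hN06∕the crux is proved here;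
YM₃ on T³ is rung R3 — NOT d = 4, NOT infinite volume, NOT a mass gap, NOT Clay.
[cite: Balaban1985BackgroundPropagators, (3.8)-(3.10) p.392, (3.19)-(3.26) pp.393-395]
-/

noncomputable section

open scoped InnerProductSpace ComplexConjugate BigOperators Matrix.Norms.L2Operator

namespace Summit.QuantumFields.YangMills.Theorems.Prop7DivRecoveryMemberCorePackaged

open Literature.MathematicalPhysics.QuantumFieldTheory.Balaban1983to89
open Literature.MathematicalPhysics.QuantumFieldTheory.Balaban1983to89.T3ContinuumYM3Torus
open Literature.MathematicalPhysics.QuantumFieldTheory.Balaban1983to89.T3PrintedRegularMinimiser (RegPr)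
open Literature.MathematicalPhysics.QuantumLattice (blockBase)
open T3LevelShift (bondShift)
open T3PrintedRegularOrbits (sites_eq)
open T3SectALandauChart (bgUnits)
open B7Eq78Linearization (conjR)
open B7Prop1Explicit (U1)
open B10Eq27TorusAxialLog (transl holT unitsField toUField)
open T4TermwiseTorus (tlift)
open B11Eq103H1Complex (SiteL2K BondL2K)
open Summit.QuantumFields.YangMills.Theorems.Prop7SymAvgGL (descendToGL)
open Summit.QuantumFields.YangMills.Theorems.Prop7SectET3Transport (periodsT3)
open Summit.QuantumFields.YangMills.Theorems.Prop7SectET3HilbertLetters (W₂ toL2S DL2 DstarL2 covLapSite)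
open Summit.QuantumFields.YangMills.Theorems.Prop7SectET3CombLetters (Qkc)
open Summit.QuantumFields.YangMills.Theorems.Prop7SPrint (basePt)
open Summit.QuantumFields.YangMills.Theorems.Prop7QprimeCombL2 (QprimeCombL2 RcombL2)
open Summit.QuantumFields.YangMills.Theorems.Prop7TwistedIntertwining (intertwining_rows)
open Summit.QuantumFields.YangMills.Theorems.Prop7DescentStraightCloseness (descent_straight_closeness)
open Summit.QuantumFields.YangMills.Theorems.Prop7DivRecoveryAssemblyHilbert (member_core_row)

variable (c₀ cB : ℕ → ℝ) [hc₀ : ∀ L : ℕ, Fact (0 < c₀ L)] [hcB : ∀ L : ℕ, Fact (0 < cB L)]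
set_option maxHeartbeats 400000 in
/-- ★★★ **(B7-MEMBER-CORE-PACKAGED).**  See the module docstring: ✓`member_core_row` with (B2a) `hB2a` (SIGNATURE-0 VERBATIM) at `T := Ū`, (B3a)∕(B3c) BY NAME, (QH1)♮ `hQH1`
for a nonnegative member functional `H`, the coarse contractions `hGQ` (= ✓`coarse_rows c₀`); constants `a₁ a₂ a₃ a₄` and the radius `eM` chosen before the member.
[cite: Balaban1985BackgroundPropagators, (3.8)-(3.10) p.392, (3.19)-(3.26) pp.393-395] -/
theorem member_core_row_packaged
    (hB2a : ∀ (L : ℕ), 1 < L → ∀ (CT : ℝ), 0 ≤ CT → ∃ CJ CJ' CJ'' e2 : ℝ, 0 ≤ CJ ∧ 0 ≤ CJ' ∧ 0 ≤ CJ'' ∧ 0 < e2 ∧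
        ∀ (F : T3Family), F.L = L → ∀ (n K : ℕ) (hnK : n < K) (e : ℝ), 0 ≤ e → e ≤ e2 →
          ∀ (W : GaugeField (F.P K) 0 (Matrix.specialUnitaryGroup (Fin 2) ℂ)), RegPr F n K e W →
          ∀ (T : PBond (F.P K) (K - n) → (Matrix (Fin 2) (Fin 2) ℂ)ˣ), (∀ c, T c ∈ U1 (Matrix (Fin 2) (Fin 2) ℂ)) →
            (∀ c : PBond (F.P K) (K - n),
              ‖(T c : Matrix (Fin 2) (Fin 2) ℂ) - ((holT (unitsField (toUField W)) (transl (basePt F n K) (blockBase ((F.P K).L ^ (K - n)) (tlift c.src)))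
                  (List.replicate ((F.P K).L ^ (K - n)) (c.dir, true)) : (Matrix (Fin 2) (Fin 2) ℂ)ˣ) : Matrix (Fin 2) (Fin 2) ℂ)‖ ≤ CT * e) →
          ∃ J : (Site (F.P K) (K - n) → Matrix (Fin 2) (Fin 2) ℂ) →ₗ[ℂ] SiteL2K ℂ 3 (periodsT3 F K) (c₀ F.L) W₂,
            (∀ w, QprimeCombL2 F n K (c₀ F.L) W (J w) = w) ∧
            (∀ w, ‖DL2 F n K (c₀ F.L) W (J w)‖ ^ 2
                ≤ CJ * (c₀ F.L * ((F.L : ℝ) ^ (K - n)) ^ 3 * ∑ c : PBond (F.P K) (K - n), ‖conjR (T c) (w (c.src.shift c.dir)) - w c.src‖ ^ 2)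
                  + CJ' * e ^ 2 * (c₀ F.L * ((F.L : ℝ) ^ (K - n)) ^ 3 * ∑ y : Site (F.P K) (K - n), ‖w y‖ ^ 2)) ∧
            (∀ w, ‖J w‖ ^ 2 ≤ CJ'' * (c₀ F.L * ((F.L : ℝ) ^ (K - n)) ^ 3 * ∑ y : Site (F.P K) (K - n), ‖w y‖ ^ 2)))
    (H : ∀ (F : T3Family) (n K : ℕ) (W : GaugeField (F.P K) 0 (Matrix.specialUnitaryGroup (Fin 2) ℂ)), BondL2K ℂ 3 (periodsT3 F K) (c₀ F.L) W₂ → ℝ)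
    (hH0 : ∀ F n K W f, 0 ≤ H F n K W f)
    (hQH1 : ∀ (L : ℕ), 1 < L → ∃ B B' B'' eQ : ℝ, 0 ≤ B ∧ 0 ≤ B' ∧ 0 ≤ B'' ∧ 0 < eQ ∧
      ∀ (F : T3Family), F.L = L → ∀ (n K : ℕ) (hnK : n < K) (e : ℝ) (W : GaugeField (F.P K) 0 (Matrix.specialUnitaryGroup (Fin 2) ℂ)),
        0 < e → e ≤ eQ → RegPr F n K e W →
        ∀ f : BondL2K ℂ 3 (periodsT3 F K) (c₀ F.L) W₂,
          (c₀ F.L / cB F.L) * ((F.L : ℝ) ^ (K - n)) ^ 3 * ‖Qkc F n K hnK.le (c₀ F.L) (cB F.L) W f‖ ^ 2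
            ≤ B * ‖f‖ ^ 2 + B' * H F n K W f + B'' * e * ‖f‖ ^ 2)
    (hGQ : ∀ (L : ℕ), 1 < L → ∃ eN : ℝ, 0 < eN ∧
      ∀ (F : T3Family), F.L = L → ∀ (n K : ℕ) (hnK : n < K) (e : ℝ), 0 < e → e ≤ eN →
        ∀ (W : GaugeField (F.P K) 0 (Matrix.specialUnitaryGroup (Fin 2) ℂ)), RegPr F n K e W →
          (∀ w : Site (F.P K) (K - n) → Matrix (Fin 2) (Fin 2) ℂ,
            c₀ F.L * ((F.L : ℝ) ^ (K - n)) ^ 3 * ∑ c : PBond (F.P K) (K - n), ‖conjR (descendToGL F n K hnK.le (bgUnits F K W) ((bondShift (sites_eq F n K hnK.le)).symm c))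
                (w (c.src.shift c.dir)) - w c.src‖ ^ 2
              ≤ 12 * (c₀ F.L * ((F.L : ℝ) ^ (K - n)) ^ 3 * ∑ y : Site (F.P K) (K - n), ‖w y‖ ^ 2)) ∧
          (∀ μ : SiteL2K ℂ 3 (periodsT3 F K) (c₀ F.L) W₂,
            c₀ F.L * ((F.L : ℝ) ^ (K - n)) ^ 3 * ∑ y : Site (F.P K) (K - n), ‖QprimeCombL2 F n K (c₀ F.L) W μ y‖ ^ 2 ≤ 1 * ‖μ‖ ^ 2)) :
    ∀ (L : ℕ), 1 < L → ∃ a₁ a₂ a₃ a₄ eM : ℝ, 0 ≤ a₁ ∧ 0 ≤ a₂ ∧ 0 ≤ a₃ ∧ 0 ≤ a₄ ∧ 0 < eM ∧ eM ≤ 1 ∧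
      ∀ (F : T3Family), F.L = L → ∀ (n K : ℕ) (hnK : n < K) (e : ℝ) (W : GaugeField (F.P K) 0 (Matrix.specialUnitaryGroup (Fin 2) ℂ)),
        0 < e → e ≤ eM → RegPr F n K e W →
        ∀ {ι : Type} [Fintype ι]
          (Z : ι → SiteL2K ℂ 3 (periodsT3 F K) (c₀ F.L) W₂ →ₗ[ℂ] SiteL2K ℂ 3 (periodsT3 F K) (c₀ F.L) W₂) (_hZ : ∀ s, ∑ i, Z i s = s)
          (ZE : ι → BondL2K ℂ 3 (periodsT3 F K) (c₀ F.L) W₂ →ₗ[ℂ] BondL2K ℂ 3 (periodsT3 F K) (c₀ F.L) W₂) (_hZE : ∀ f, ∑ i, ZE i f = f)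
          (y : BondL2K ℂ 3 (periodsT3 F K) (c₀ F.L) W₂) (φ κs : ι → SiteL2K ℂ 3 (periodsT3 F K) (c₀ F.L) W₂)
          (_hloc : ∀ i, Z i (DstarL2 F n K (c₀ F.L) W y) = Z i (covLapSite F n K (c₀ F.L) W (φ i)) + Z i (κs i))
          (r : ι → BondL2K ℂ 3 (periodsT3 F K) (c₀ F.L) W₂) (_hDφ : ∀ i, ZE i (DL2 F n K (c₀ F.L) W (φ i)) = ZE i y - ZE i (r i)),
        ‖DstarL2 F n K (c₀ F.L) W y - RcombL2 F n K (c₀ F.L) W (DstarL2 F n K (c₀ F.L) W y)‖ ^ 2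
          ≤ a₁ * ((c₀ F.L / cB F.L) * ((F.L : ℝ) ^ (K - n)) ^ 3 * ‖Qkc F n K hnK.le (c₀ F.L) (cB F.L) W y‖ ^ 2)
            + a₂ * (‖∑ i, ZE i (r i)‖ ^ 2 + ‖∑ i, (DL2 F n K (c₀ F.L) W (Z i (φ i)) - ZE i (DL2 F n K (c₀ F.L) W (φ i)))‖ ^ 2)
            + a₃ * (H F n K W (∑ i, ZE i (r i)) + H F n K W (∑ i, (DL2 F n K (c₀ F.L) W (Z i (φ i)) - ZE i (DL2 F n K (c₀ F.L) W (φ i)))))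
            + a₄ * e ^ 2 * ‖∑ i, Z i (φ i)‖ ^ 2
            + 3 * ‖∑ i, (covLapSite F n K (c₀ F.L) W (Z i (φ i)) - Z i (covLapSite F n K (c₀ F.L) W (φ i)))‖ ^ 2
            + 3 * ‖∑ i, Z i (κs i)‖ ^ 2 := by
  intro L hL
  -- the riders of the transporter of record
  obtain ⟨C3, e3, hC3, he3, h3⟩ := intertwining_rows c₀ cB L hL
  obtain ⟨CT, e3', hCT, he3', hclose⟩ := descent_straight_closeness L hL
  obtain ⟨CJ, CJ', CJ'', e2, hCJ, hCJ', hCJ'', he2, hJ⟩ := hB2a L hL CT hCT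
  obtain ⟨B, B', B'', eQ, hB, hB', hB'', heQ, hQ⟩ := hQH1 L hL
  obtain ⟨eN, heN, hGQ'⟩ := hGQ L hL
  have hCG : (0 : ℝ) ≤ 12 := by norm_num
  have hCN : (0 : ℝ) ≤ 1 := by norm_num
  have hc : 0 < c₀ L := (hc₀ L).out
  have hb : 0 < cB L := (hcB L).out
  set K2 : ℝ := CJ * 12 * 1 + CJ' * 1 + 1 with hK2def
  have hK2 : 0 ≤ K2 := by rw [hK2def]; positivity
  refine ⟨288 * K2 * CJ, 288 * K2 * CJ * (B + B''), 288 * K2 * CJ * B', 48 * K2 * (CJ * ((c₀ L / cB L) * C3) + CJ' * 1),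
    min (min e2 (min e3 e3')) (min (min eQ eN) 1), by positivity, by positivity, by positivity, by positivity,
    lt_min (lt_min he2 (lt_min he3 he3')) (lt_min (lt_min heQ heN) one_pos), (min_le_right _ _).trans (min_le_right _ _), ?_⟩
  intro F hF n K hnK e W he heM hreg ι _ Z hZ ZE hZE y φ κs hloc r hDφ
  have he2' : e ≤ e2 := heM.trans ((min_le_left _ _).trans (min_le_left _ _))
  have he3a : e ≤ e3 := heM.trans ((min_le_left _ _).trans ((min_le_right _ _).trans (min_le_left _ _)))
  have he3b : e ≤ e3' := heM.trans ((min_le_left _ _).trans ((min_le_right _ _).trans (min_le_right _ _)))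
  have heQ' : e ≤ eQ := heM.trans ((min_le_right _ _).trans ((min_le_left _ _).trans (min_le_left _ _)))
  have heN' : e ≤ eN := heM.trans ((min_le_right _ _).trans ((min_le_left _ _).trans (min_le_right _ _)))
  obtain ⟨hG, hN⟩ := hGQ' F hF n K hnK e he heN' W hreg
  have he1 : e ≤ 1 := heM.trans ((min_le_right _ _).trans (min_le_right _ _))
  -- (B3a) and the U1 rider at this member
  obtain ⟨hU, h3a, -⟩ := h3 F hF n K hnK e he.le he3a W hreg
  -- (B2a) at `T := Ū`
  obtain ⟨J, hQJ, hJrow, -⟩ := hJ F hF n K hnK e he.le he2' W hreg _ hU (hclose F hF n K hnK e he he3b W hreg)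
  -- (QH1) with `B″e ≤ B″`
  have hQH1' : ∀ f : BondL2K ℂ 3 (periodsT3 F K) (c₀ F.L) W₂,
      (c₀ F.L / cB F.L) * ((F.L : ℝ) ^ (K - n)) ^ 3 * ‖Qkc F n K hnK.le (c₀ F.L) (cB F.L) W f‖ ^ 2 ≤ (B + B'') * ‖f‖ ^ 2 + B' * H F n K W f := by
    intro f
    have h := hQ F hF n K hnK e W he heQ' hreg f
    have : B'' * e * ‖f‖ ^ 2 ≤ B'' * ‖f‖ ^ 2 := by
      have := mul_le_mul_of_nonneg_left he1 (mul_nonneg hB'' (sq_nonneg ‖f‖))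
      nlinarith
    linarith
  -- the member core row
  have hcore := member_core_row c₀ cB F n K hnK e W h3a hCG hCN hG hN J hQJ hCJ hCJ' hJrow
    (H F n K W) hQH1' Z hZ ZE hZE y φ κs hloc r hDφ
  subst hF
  -- κ² ≤ K2 (e ≤ 1) and monotonicity in the nonnegative terms
  set κ2 : ℝ := CJ * 12 * 1 + CJ' * 1 * e ^ 2 + 1 with hκ2def
  have hκ : κ2 ≤ K2 := by
    rw [hκ2def, hK2def]
    have he2le : e ^ 2 ≤ 1 := by nlinarith
    have := mul_le_mul_of_nonneg_left he2le (mul_nonneg hCJ' hCN)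
    nlinarith
  have hκ0 : 0 ≤ κ2 := by rw [hκ2def]; positivity
  set X1 := (c₀ F.L / cB F.L) * ((F.L : ℝ) ^ (K - n)) ^ 3 * ‖Qkc F n K hnK.le (c₀ F.L) (cB F.L) W y‖ ^ 2 with hX1def
  set X2 := ‖∑ i, ZE i (r i)‖ ^ 2 + ‖∑ i, (DL2 F n K (c₀ F.L) W (Z i (φ i)) - ZE i (DL2 F n K (c₀ F.L) W (φ i)))‖ ^ 2 with hX2def
  set X3 := H F n K W (∑ i, ZE i (r i)) + H F n K W (∑ i, (DL2 F n K (c₀ F.L) W (Z i (φ i)) - ZE i (DL2 F n K (c₀ F.L) W (φ i)))) with hX3def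
  set X5 := ‖∑ i, Z i (φ i)‖ ^ 2 with hX5def
  have hX1 : 0 ≤ X1 := by rw [hX1def]; exact mul_nonneg (mul_nonneg (div_nonneg (hc₀ F.L).out.le (hcB F.L).out.le) (pow_nonneg (pow_nonneg (Nat.cast_nonneg _) _) _)) (sq_nonneg _)
  have hX2 : 0 ≤ X2 := by rw [hX2def]; exact add_nonneg (sq_nonneg _) (sq_nonneg _)
  have hX3 : 0 ≤ X3 := by rw [hX3def]; exact add_nonneg (hH0 _ _ _ _ _) (hH0 _ _ _ _ _)
  have hX5 : 0 ≤ X5 := by rw [hX5def]; exact sq_nonneg _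
  have hA0 : 0 ≤ CJ * ((c₀ F.L / cB F.L) * C3) + CJ' * 1 := by positivity
  have hB1 : 0 ≤ B + B'' := by positivity
  have t1 : κ2 * (288 * CJ * X1) ≤ K2 * (288 * CJ * X1) :=
    mul_le_mul_of_nonneg_right hκ (mul_nonneg (mul_nonneg (by norm_num) hCJ) hX1)
  have t2 : κ2 * (288 * CJ * (B + B'') * X2) ≤ K2 * (288 * CJ * (B + B'') * X2) :=
    mul_le_mul_of_nonneg_right hκ (mul_nonneg (mul_nonneg (mul_nonneg (by norm_num) hCJ) hB1) hX2)
  have t3 : κ2 * (288 * CJ * B' * X3) ≤ K2 * (288 * CJ * B' * X3) :=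
    mul_le_mul_of_nonneg_right hκ (mul_nonneg (mul_nonneg (mul_nonneg (by norm_num) hCJ) hB') hX3)
  have t4 : κ2 * (48 * (CJ * ((c₀ F.L / cB F.L) * C3) + CJ' * 1) * e ^ 2 * X5)
      ≤ K2 * (48 * (CJ * ((c₀ F.L / cB F.L) * C3) + CJ' * 1) * e ^ 2 * X5) :=
    mul_le_mul_of_nonneg_right hκ (mul_nonneg (mul_nonneg (mul_nonneg (by norm_num) hA0) (sq_nonneg e)) hX5)
  linarith

end Summit.QuantumFields.YangMills.Theorems.Prop7DivRecoveryMemberCorePackaged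

end
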